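import Summits.Parity.GeneralizedHardyLittlewood.Theses.LiouvilleShiftedTables
import Summits.Parity.GeneralizedHardyLittlewood.Theorems.TableChowla.Negative.TableChowlaBandReduction

/-!
# `TableChowla` (stmt-Parity-14270): tools for the corner (local box) domination — pair-sum
# regrouping and window overlap weights

Support lemmas for the crux `LiouvilleShiftedTables.TableChowla` (cdisprove seat), used by
`TableChowlaCornerDomination`: exact window-overlap counts (`card_overlap_eq`, `sum_overlap_le`),
the overlap weight as a symmetric function (`overlapW`, `overlapW_symm`), regrouping of the pairs of
a finite set of naturals into diagonal / strict upper / strict lower pairs (`sum_pairs_split`,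
`sum_lower_pairs_eq`, `sum_pairs_symm`) and of the strict upper pairs by their gap
(`sum_upper_pairs_eq_sum_gaps`, `sum_upper_window`, `sum_filter_comm`), and the 4-point box
product of table entries (`boxProd`, `cornerRes` = restricted corner sum at positive gaps).
[folklore]
-/

namespace Summit.Parity.GeneralizedHardyLittlewood.Theorems.TableChowla.Negative

open Finset Real ArithmeticFunction
open Summit.Parity.GeneralizedHardyLittlewood.Theses

noncomputable section

variable {I M : Finset ℕ} {H : ℕ}

/-- Exact overlap count for two windows inside `M`: `#([a,a+H) ∩ [a+h,a+h+H) ∩ M) = H − h`. -/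
theorem card_overlap_eq {a h : ℕ} (haM : ∀ m, a ≤ m → m < a + H → m ∈ M) (hh : h < H) :
    (M.filter (fun m => (a ≤ m ∧ m < a + H) ∧ (a + h ≤ m ∧ m < a + h + H))).card = H - h := by
  have : M.filter (fun m => (a ≤ m ∧ m < a + H) ∧ (a + h ≤ m ∧ m < a + h + H)) = Finset.Ico (a + h) (a + H) := by
    ext m
    simp only [mem_filter, Finset.mem_Ico]
    constructor
    · rintro ⟨_, ⟨_, h2⟩, h3, _⟩; exact ⟨h3, h2⟩
    · rintro ⟨h1, h2⟩; exact ⟨haM m (by omega) h2, ⟨by omega, h2⟩, h1, by omega⟩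
  rw [this, Nat.card_Ico]
  omega

/-- At most `2H − 1` (so `≤ 2H`) members of any set lie in the band around `a`. -/
theorem card_band_le (S : Finset ℕ) (a : ℕ) :
    (S.filter (fun a' => a' < a + H ∧ a < a' + H)).card ≤ 2 * H := by
  calc (S.filter (fun a' => a' < a + H ∧ a < a' + H)).card
      ≤ (Finset.Ico (a + 1 - H) (a + H)).card := by
        apply card_le_card
        intro a' ha'
        simp only [mem_filter] at ha'
        rw [Finset.mem_Ico]; omega
    _ ≤ 2 * H := by rw [Nat.card_Ico]; omega

/-- Sum of overlap weights over one index is `≤ 2H²`. -/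
theorem sum_overlap_le (S : Finset ℕ) (a : ℕ) (haM : ∀ m, a ≤ m → m < a + H → m ∈ M) :
    ∑ a' ∈ S, ((M.filter (fun m => (a ≤ m ∧ m < a + H) ∧ (a' ≤ m ∧ m < a' + H))).card : ℝ) ≤
      2 * (H : ℝ) ^ 2 := by
  rw [← sum_filter_add_sum_filter_not S (fun a' => a' < a + H ∧ a < a' + H)]
  have hzero : ∑ a' ∈ S.filter (fun a' => ¬ (a' < a + H ∧ a < a' + H)),
      ((M.filter (fun m => (a ≤ m ∧ m < a + H) ∧ (a' ≤ m ∧ m < a' + H))).card : ℝ) = 0 := by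
    refine sum_eq_zero fun a' ha' => ?_
    rw [card_overlap_eq_zero (mem_filter.mp ha').2, Nat.cast_zero]
  rw [hzero, add_zero]
  calc ∑ a' ∈ S.filter (fun a' => a' < a + H ∧ a < a' + H),
        ((M.filter (fun m => (a ≤ m ∧ m < a + H) ∧ (a' ≤ m ∧ m < a' + H))).card : ℝ)
      ≤ ∑ _a' ∈ S.filter (fun a' => a' < a + H ∧ a < a' + H), (H : ℝ) := by
        refine sum_le_sum fun a' _ => ?_
        exact_mod_cast card_overlap_le haM
    _ = ((S.filter (fun a' => a' < a + H ∧ a < a' + H)).card : ℝ) * H := by rw [sum_const, nsmul_eq_mul]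
    _ ≤ (2 * H) * H := by
        apply mul_le_mul_of_nonneg_right _ (Nat.cast_nonneg _)
        exact_mod_cast card_band_le S a
    _ = 2 * (H : ℝ) ^ 2 := by ring

/-- Regrouping the STRICT UPPER pairs of `I × I` by the gap `h = a' − a ∈ [1, D)`, for any `D`
exceeding the diameter. -/
theorem sum_upper_pairs_eq_sum_gaps (I : Finset ℕ) (F : ℕ → ℕ → ℝ) (D : ℕ)
    (hD : ∀ a ∈ I, ∀ a' ∈ I, a' < a + D) :
    ∑ a ∈ I, ∑ a' ∈ I.filter (fun a' => a < a'), F a a' =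
      ∑ a ∈ I, ∑ h ∈ (Finset.Ico 1 D).filter (fun h => a + h ∈ I), F a (a + h) := by
  refine sum_congr rfl fun a ha => ?_
  have hinj : Set.InjOn (fun h => a + h) ((Finset.Ico 1 D).filter (fun h => a + h ∈ I) : Finset ℕ) :=
    fun h _ h' _ hh => by simpa using hh
  rw [← sum_image hinj]
  refine sum_congr ?_ fun _ _ => rfl
  ext a'
  simp only [mem_filter, mem_image, Finset.mem_Ico]
  constructor
  · rintro ⟨ha', hlt⟩
    exact ⟨a' - a, ⟨⟨by omega, by have := hD a ha a' ha'; omega⟩, by rwa [show a + (a' - a) = a' by omega]⟩, by omega⟩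
  · rintro ⟨h, ⟨⟨h1, _⟩, hmem⟩, rfl⟩
    exact ⟨hmem, by omega⟩

/-- Symmetry: the strict LOWER pairs contribute the transpose of the strict upper ones. -/
theorem sum_lower_pairs_eq (I : Finset ℕ) (F : ℕ → ℕ → ℝ) :
    ∑ a ∈ I, ∑ a' ∈ I.filter (fun a' => a' < a), F a a' = ∑ a ∈ I, ∑ a' ∈ I.filter (fun a' => a < a'), F a' a := by
  simp only [sum_filter]
  rw [sum_comm]

/-- Splitting `I × I` into diagonal, strict upper and strict lower pairs. -/
theorem sum_pairs_split (I : Finset ℕ) (F : ℕ → ℕ → ℝ) :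
    ∑ a ∈ I, ∑ a' ∈ I, F a a' = ∑ a ∈ I, F a a + ∑ a ∈ I, ∑ a' ∈ I.filter (fun a' => a < a'), F a a' +
      ∑ a ∈ I, ∑ a' ∈ I.filter (fun a' => a' < a), F a a' := by
  rw [← sum_add_distrib, ← sum_add_distrib]
  refine sum_congr rfl fun a ha => ?_
  rw [sum_filter, sum_filter]
  have hdiag : F a a = ∑ a' ∈ I, if a' = a then F a a' else 0 := by
    rw [Finset.sum_ite_eq', if_pos ha]
  rw [hdiag, ← sum_add_distrib, ← sum_add_distrib]
  refine sum_congr rfl fun a' _ => ?_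
  rcases lt_trichotomy a a' with hlt | heq | hgt
  · rw [if_neg (by omega), if_pos hlt, if_neg (by omega)]; ring
  · subst heq; simp
  · rw [if_neg (by omega), if_neg (by omega), if_pos hgt]; ring

/-- The overlap weight as a function. -/
def overlapW (M : Finset ℕ) (H a a' : ℕ) : ℝ :=
  ((M.filter (fun m => (a ≤ m ∧ m < a + H) ∧ (a' ≤ m ∧ m < a' + H))).card : ℝ)

/-- The overlap weight is symmetric. -/
theorem overlapW_symm (M : Finset ℕ) (H a a' : ℕ) : overlapW M H a a' = overlapW M H a' a := by
  unfold overlapW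
  rw [Finset.filter_congr (fun m _ => and_comm)]

/-- The overlap weight is non-negative. -/
theorem overlapW_nonneg (M : Finset ℕ) (H a a' : ℕ) : 0 ≤ overlapW M H a a' := Nat.cast_nonneg _

/-- Symmetric collapse: for a symmetric `G`, `Σ_{a,a'∈I} G = Σ_a G a a + 2·Σ_a Σ_{a'>a} G a a'`. -/
theorem sum_pairs_symm (I : Finset ℕ) (G : ℕ → ℕ → ℝ) (hG : ∀ a a', G a a' = G a' a) :
    ∑ a ∈ I, ∑ a' ∈ I, G a a' = ∑ a ∈ I, G a a + 2 * ∑ a ∈ I, ∑ a' ∈ I.filter (fun a' => a < a'), G a a' := by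
  rw [sum_pairs_split, sum_lower_pairs_eq]
  have : ∑ a ∈ I, ∑ a' ∈ I.filter (fun a' => a < a'), G a' a = ∑ a ∈ I, ∑ a' ∈ I.filter (fun a' => a < a'), G a a' :=
    sum_congr rfl fun a _ => sum_congr rfl fun a' _ => (hG a a').symm
  rw [this]
  ring

/-- Strict upper pairs whose far terms vanish beyond the window, regrouped by the gap. -/
theorem sum_upper_window (I : Finset ℕ) (F : ℕ → ℕ → ℝ) (Hw : ℕ)
    (hvan : ∀ a ∈ I, ∀ a' ∈ I, a + Hw ≤ a' → F a a' = 0) :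
    ∑ a ∈ I, ∑ a' ∈ I.filter (fun a' => a < a'), F a a' =
      ∑ a ∈ I, ∑ h ∈ (Finset.Ico 1 Hw).filter (fun h => a + h ∈ I), F a (a + h) := by
  refine sum_congr rfl fun a ha => ?_
  -- first restrict to a' < a + Hw (the rest vanishes)
  have hrestrict : ∑ a' ∈ I.filter (fun a' => a < a'), F a a' =
      ∑ a' ∈ I.filter (fun a' => a < a' ∧ a' < a + Hw), F a a' := by
    rw [sum_filter, sum_filter]
    refine sum_congr rfl fun a' ha' => ?_
    by_cases h1 : a < a'
    · by_cases h2 : a' < a + Hw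
      · rw [if_pos h1, if_pos ⟨h1, h2⟩]
      · rw [if_pos h1, if_neg (fun h => h2 h.2), hvan a ha a' ha' (by omega)]
    · rw [if_neg h1, if_neg (fun h => h1 h.1)]
  rw [hrestrict]
  have hinj : Set.InjOn (fun h => a + h) ((Finset.Ico 1 Hw).filter (fun h => a + h ∈ I) : Finset ℕ) :=
    fun h _ h' _ hh => by simpa using hh
  rw [← sum_image hinj]
  refine sum_congr ?_ fun _ _ => rfl
  ext a'
  simp only [mem_filter, mem_image, Finset.mem_Ico]
  constructor
  · rintro ⟨ha', hlt, hlt2⟩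
    exact ⟨a' - a, ⟨⟨by omega, by omega⟩, by rwa [show a + (a' - a) = a' by omega]⟩, by omega⟩
  · rintro ⟨h, ⟨⟨h1, h2⟩, hmem⟩, rfl⟩
    exact ⟨hmem, by omega, by omega⟩

/-- Commuting an index sum with a filtered gap sum. -/
theorem sum_filter_comm (I T : Finset ℕ) (X : ℕ → ℕ → ℝ) :
    ∑ a ∈ I, ∑ h ∈ T.filter (fun h => a + h ∈ I), X a h = ∑ h ∈ T, ∑ a ∈ I.filter (fun a => a + h ∈ I), X a h := by
  simp only [sum_filter]
  rw [sum_comm]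

/-- The 4-point (box) product of table entries at rows `a, a'` and columns `b, b'`. -/
def boxProd (f : ℕ → ℝ) (c : ℤ) (a a' b b' : ℕ) : ℝ :=
  f (Int.toNat ((a : ℤ) * b + c)) * f (Int.toNat ((a' : ℤ) * b + c)) *
    (f (Int.toNat ((a : ℤ) * b' + c)) * f (Int.toNat ((a' : ℤ) * b' + c)))

/-- RESTRICTED CORNER SUM at POSITIVE gaps `(h,k)`: all four corners inside the table. -/
def cornerRes (f : ℕ → ℝ) (c : ℤ) (A₁ A₂ B h k : ℕ) : ℝ :=
  ∑ a ∈ (Ioc A₁ A₂).filter (fun a => a + h ∈ Ioc A₁ A₂),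
    ∑ b ∈ (Icc 1 B).filter (fun b => b + k ∈ Icc 1 B), boxProd f c a (a + h) b (b + k)

variable {f : ℕ → ℝ} {c : ℤ} {A₁ A₂ B : ℕ}

/-- The box product is symmetric in the two rows. -/
theorem boxProd_symm_rows (a a' b b' : ℕ) : boxProd f c a a' b b' = boxProd f c a' a b b' := by
  unfold boxProd; ring

/-- The box product is symmetric in the two columns. -/
theorem boxProd_symm_cols (a a' b b' : ℕ) : boxProd f c a a' b b' = boxProd f c a a' b' b := by
  unfold boxProd; ring

/-- `|boxProd| ≤ 1` for `|f| ≤ 1`. -/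
theorem abs_boxProd_le (hf : ∀ n, |f n| ≤ 1) (a a' b b' : ℕ) : |boxProd f c a a' b b'| ≤ 1 := by
  unfold boxProd
  rw [abs_mul, abs_mul, abs_mul]
  have h1 := hf (Int.toNat ((a : ℤ) * b + c)); have h2 := hf (Int.toNat ((a' : ℤ) * b + c))
  have h3 := hf (Int.toNat ((a : ℤ) * b' + c)); have h4 := hf (Int.toNat ((a' : ℤ) * b' + c))
  calc |f (Int.toNat ((a : ℤ) * b + c))| * |f (Int.toNat ((a' : ℤ) * b + c))| *
        (|f (Int.toNat ((a : ℤ) * b' + c))| * |f (Int.toNat ((a' : ℤ) * b' + c))|) ≤ 1 * 1 * (1 * 1) := by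
        gcongr
    _ = 1 := by ring


end

end Summit.Parity.GeneralizedHardyLittlewood.Theorems.TableChowla.Negative
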